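import Summits.ValiantsHypothesis.ValiantsHypothesis.Theorems.GrenetZeonDualUnipotentThreeHalvesLongMassIrreducibilityFree
import Summits.ValiantsHypothesis.ValiantsHypothesis.Theorems.GrenetZeonDualUnipotentThreeHalvesHeavyTopBand

/-!
# `GrenetZeon.DualUnipotentThreeHalves` (stmt-ValiantsHypothesis-24318), line `slow_core`, stub (c) `SlowCore.LongMassSlowLawInv`:
# HOMOGENISATION — the constant part is FREE in (c)

The registered research stub (c) `SlowCore.LongMassSlowLawInv` (⟺ ✓ `LongMassIrreducibilityFree.LongMassSlowLawAll`, irreducibility is free)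
quantifies over AFFINE nilpotent pencils `B : AffMat n b` (entries of total degree `≤ 1`, constant part `B(0)` arbitrary, `B ^ b = 0`).  Every
census row, enemy template and instrument of the cell is written for LINEAR pencils (constant part `0`; the «value space» `W̄ = im lin B` of
crit-7 V34).  This file makes that convention BY NAME without loss:

* `longMassSlowLawAll_iff_linear` / `longMassSlowLawInv_iff_linear` — (c) holds iff it holds for the LINEAR nilpotent pencils
  (`∀ i j, coeff 0 (B i j) = 0`); constants `c ↦ 2c`, `n₀ ↦ max n₀ 1`.

MATHEMATICS (homogenisation with one spare coordinate).  Given an affine nilpotent `b × b` pencil `N` over the `n²` coordinates, embed the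
coordinates into the `(n+1)²` coordinates by `ι = castSucc × castSucc` and let the spare slot `s₀ = (last, last)` carry the constant part:
`N⁺ := Σ_e [x_e]N · X_{ι e} + N(0) · X_{s₀}` (linear).  (1) `N⁺` is nilpotent: its value at a point with spare coordinate `t ≠ 0` is
`t · N(t⁻¹·w)`, and with `t = 0` it is the linear part `lin N (w)`, nilpotent by ✓ `RadicalSplit.linPart_pow_eq_zero`; a polynomial matrix all of
whose values have vanishing `b`-th power has vanishing `b`-th power (`MvPolynomial.funext`).  (2) A whole-pencil certificate `(K', k)` of `N⁺`
over the `(n+1)²` coordinates restricts to the certificate `(K, k)`, `K := E⁻¹ K'` (`E` = extension by zero along `ι`), of `N` over the `n²`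
coordinates: along `v ∈ K` at the base point `x⁺ = (x, spare 1)` the pulled-back line of `N⁺` IS the line `N(x + s v)` (`map_lineSubst_homog`),
the window `p ≤ n − 1` is inside the window `p ≤ n`, and the PRICE DOES NOT GROW: `codim_{n²} K ≤ codim_{(n+1)²} K'`
(`dim K = dim (K' ⊓ range E) ≥ dim K' − (2n+1)`) and `n·k ≤ (n+1)·k` (`relCert_of_homog`).  (3) `c·√(n+1)·b ≤ 2c·√n·b` for `n ≥ 1`.

All statements are def-free: the homogenised pencil `N'` over `n'²` coordinates enters through the hypothesis
`hN' : ∀ i j, N' i j = Σ_e C([x_e]N_ij)·X(ι e) + C(N_ij(0))·X s₀` for an arbitrary injective `ι` and a spare slot `s₀ ∉ range ι`.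

Honest framing.  A REFORMULATION / support lemma (`--supports stmt-ValiantsHypothesis-24318`), NOT progress on (c): (c)
`SlowCore.LongMassSlowLawInv`, S3, the crux 24318, 8062 and `VP ≠ VNP` remain OPEN / NOT proved.  No sorry, no definitions, no named facts.
-/

-- single-conjunct layout: Sub = Summit, duplicated namespace component intended (the name is mandated)
set_option linter.dupNamespace false
set_option autoImplicit false

noncomputable section

namespace Summit.ValiantsHypothesis.ValiantsHypothesis.Theorems.GrenetZeon.LongMassHomogenise

open MvPolynomial Matrix
open scoped BigOperators
open Summit.ValiantsHypothesis.ValiantsHypothesis.Cruxes.TwoDimCoefficients.DimTwoCases (AffMat IsAffine)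
open Summit.ValiantsHypothesis.ValiantsHypothesis.Theorems.GrenetZeon.RadicalSplit (lineSubst linPart linPart_pow_eq_zero)
open Summit.ValiantsHypothesis.ValiantsHypothesis.Theorems.GrenetZeon.SlowCore
open Summit.ValiantsHypothesis.ValiantsHypothesis.Theorems.GrenetZeon.LongMassIrreducibilityFree
  (LongMassSlowLawAll inv_of_all all_of_inv)

/-! ## §1 Affine polynomials: evaluation and the linear coefficient -/

section Affine

variable {σ : Type*} [Fintype σ]

/-- Evaluation of an affine polynomial: `p(v) = p(0) + Σ_e [x_e]p · v_e`. -/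
theorem eval_eq_of_totalDegree_le_one (p : MvPolynomial σ ℂ) (hp : p.totalDegree ≤ 1) (v : σ → ℂ) :
    eval v p = coeff 0 p + ∑ e, coeff (Finsupp.single e 1) p * v e := by
  conv_lhs => rw [Literature.Computability.AlgebraicComplexity.LRPencil.eq_affine_of_totalDegree_le_one p hp]
  simp [eval_X]

end Affine

/-! ## §2 The homogenised pencil: value formula, affinity, linearity, nilpotency -/

section Homog

variable {n n' b : ℕ} (ι : Fin n × Fin n → Fin n' × Fin n') (s₀ : Fin n' × Fin n')
  (N : AffMat n b) (N' : AffMat n' b)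

/-- VALUE FORMULA of the homogenised pencil: `N⁺_ij(y) = Σ_e [x_e]N_ij · y(ι e) + N_ij(0)-coefficient · y(s₀)`. -/
theorem eval_homog
    (hN' : ∀ i j, N' i j = (∑ e, C (coeff (Finsupp.single e 1) (N i j)) * X (ι e)) + C (coeff 0 (N i j)) * X s₀)
    (y : Fin n' × Fin n' → ℂ) (i j : Fin b) :
    eval y (N' i j) = (∑ e, coeff (Finsupp.single e 1) (N i j) * y (ι e)) + coeff 0 (N i j) * y s₀ := by
  rw [hN' i j]
  simp [eval_X, map_sum]

/-- The homogenised pencil is affine (indeed linear). -/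
theorem isAffine_homog
    (hN' : ∀ i j, N' i j = (∑ e, C (coeff (Finsupp.single e 1) (N i j)) * X (ι e)) + C (coeff 0 (N i j)) * X s₀) :
    IsAffine N' := by
  intro i j
  rw [hN' i j]
  refine (totalDegree_add _ _).trans (max_le ?_ ?_)
  · refine (totalDegree_finsetSum _ _).trans (Finset.sup_le fun e _ => ?_)
    exact (totalDegree_mul _ _).trans (by rw [totalDegree_C, totalDegree_X, zero_add])
  · exact (totalDegree_mul _ _).trans (by rw [totalDegree_C, totalDegree_X, zero_add])

/-- The homogenised pencil is LINEAR: constant part `0`. -/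
theorem coeff_zero_homog
    (hN' : ∀ i j, N' i j = (∑ e, C (coeff (Finsupp.single e 1) (N i j)) * X (ι e)) + C (coeff 0 (N i j)) * X s₀)
    (i j : Fin b) : coeff 0 (N' i j) = 0 := by
  rw [hN' i j, coeff_add, coeff_sum]
  simp [coeff_C_mul]

variable {N}

/-- Value of the homogenised pencil at spare coordinate `0`: the linear part of `N`. -/
theorem map_eval_homog_of_zero (hN : IsAffine N)
    (hN' : ∀ i j, N' i j = (∑ e, C (coeff (Finsupp.single e 1) (N i j)) * X (ι e)) + C (coeff 0 (N i j)) * X s₀)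
    (y : Fin n' × Fin n' → ℂ) (hy : y s₀ = 0) :
    N'.map (eval y) = linPart N (y ∘ ι) := by
  ext i j
  simp only [Matrix.map_apply, linPart, Matrix.sub_apply]
  rw [eval_homog ι s₀ N N' hN' y i j, hy, mul_zero, add_zero,
    eval_eq_of_totalDegree_le_one _ (hN i j), eval_eq_of_totalDegree_le_one _ (hN i j)]
  simp [Function.comp, mul_comm]

/-- Value of the homogenised pencil at spare coordinate `t ≠ 0`: `t · N(t⁻¹ · (y ∘ ι))`. -/
theorem map_eval_homog_of_ne_zero (hN : IsAffine N)
    (hN' : ∀ i j, N' i j = (∑ e, C (coeff (Finsupp.single e 1) (N i j)) * X (ι e)) + C (coeff 0 (N i j)) * X s₀)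
    (y : Fin n' × Fin n' → ℂ) (hy : y s₀ ≠ 0) :
    N'.map (eval y) = y s₀ • N.map (eval ((y s₀)⁻¹ • (y ∘ ι))) := by
  ext i j
  simp only [Matrix.map_apply, Matrix.smul_apply, smul_eq_mul]
  rw [eval_homog ι s₀ N N' hN' y i j, eval_eq_of_totalDegree_le_one _ (hN i j), mul_add, Finset.mul_sum]
  rw [add_comm]
  congr 1
  · ring
  · refine Finset.sum_congr rfl fun e _ => ?_
    simp only [Pi.smul_apply, Function.comp, smul_eq_mul]
    field_simp

/-- ★ **THE HOMOGENISED PENCIL IS NILPOTENT POINTWISE**: `N⁺(y)^b = 0` for every `y`. -/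
theorem map_eval_homog_pow_eq_zero (hN : IsAffine N) (hnil : N ^ b = 0)
    (hN' : ∀ i j, N' i j = (∑ e, C (coeff (Finsupp.single e 1) (N i j)) * X (ι e)) + C (coeff 0 (N i j)) * X s₀)
    (y : Fin n' × Fin n' → ℂ) : (N'.map (eval y)) ^ b = 0 := by
  by_cases hy : y s₀ = 0
  · rw [map_eval_homog_of_zero ι s₀ N' hN hN' y hy]
    exact linPart_pow_eq_zero N hN hnil _
  · rw [map_eval_homog_of_ne_zero ι s₀ N' hN hN' y hy, smul_pow]
    have h := Matrix.map_pow N (eval ((y s₀)⁻¹ • (y ∘ ι))) b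
    rw [hnil, Matrix.map_zero _ (map_zero _)] at h
    rw [← h, smul_zero]

/-- ★ **THE HOMOGENISED PENCIL IS NILPOTENT**: `N⁺ ^ b = 0` as a polynomial matrix. -/
theorem homog_pow_eq_zero (hN : IsAffine N) (hnil : N ^ b = 0)
    (hN' : ∀ i j, N' i j = (∑ e, C (coeff (Finsupp.single e 1) (N i j)) * X (ι e)) + C (coeff 0 (N i j)) * X s₀) :
    N' ^ b = 0 := by
  refine Matrix.ext fun i j => ?_
  apply MvPolynomial.funext
  intro y
  have h := congr_fun (congr_fun (map_eval_homog_pow_eq_zero ι s₀ N' hN hnil hN' y) i) j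
  rw [← Matrix.map_pow, Matrix.map_apply, Matrix.zero_apply] at h
  rw [h, Matrix.zero_apply, map_zero]

/-! ## §3 Restricting a certificate of the homogenised pencil -/

/-- The pulled-back line of `N⁺` at base point `x⁺` (= `x` on `ι`, `1` elsewhere) along the zero-extension of `v` IS the line `N(x + s v)`. -/
theorem map_lineSubst_homog (hι : Function.Injective ι) (hs₀ : ∀ e, ι e ≠ s₀) (hN : IsAffine N)
    (hN' : ∀ i j, N' i j = (∑ e, C (coeff (Finsupp.single e 1) (N i j)) * X (ι e)) + C (coeff 0 (N i j)) * X s₀)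
    (x v : Fin n × Fin n → ℂ) :
    N'.map (lineSubst (Function.extend ι x (fun _ => 1)) (Function.extend ι v 0)) = N.map (lineSubst x v) := by
  have hN'a := isAffine_homog ι s₀ N N' hN'
  ext i j
  simp only [Matrix.map_apply]
  rw [lineSubst_apply_of_le_one N' hN'a, lineSubst_apply_of_le_one N hN]
  have hs₀' : ¬ ∃ e, ι e = s₀ := fun ⟨e, he⟩ => hs₀ e he
  -- the constant coefficient
  have h1 : eval (Function.extend ι x (fun _ => (1 : ℂ))) (N' i j) = eval x (N i j) := by
    rw [eval_homog ι s₀ N N' hN', eval_eq_of_totalDegree_le_one _ (hN i j), Function.extend_apply' _ _ _ hs₀',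
      mul_one, add_comm]
    congr 1
    exact Finset.sum_congr rfl fun e _ => by rw [hι.extend_apply]
  -- the linear coefficient: for a LINEAR polynomial it is the value
  have h2 : linEntry N' i j (Function.extend ι v (0 : Fin n' × Fin n' → ℂ)) = linEntry N i j v := by
    have hlin : linEntry N' i j (Function.extend ι v (0 : Fin n' × Fin n' → ℂ)) =
        eval (Function.extend ι v (0 : Fin n' × Fin n' → ℂ)) (N' i j) := by
      rw [eval_eq_of_totalDegree_le_one _ (hN'a i j), coeff_zero_homog ι s₀ N N' hN', zero_add, linEntry]
      exact Finset.sum_congr rfl fun e _ => mul_comm _ _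
    rw [hlin, eval_homog ι s₀ N N' hN', Function.extend_apply' _ _ _ hs₀', Pi.zero_apply, mul_zero, add_zero,
      linEntry]
    exact Finset.sum_congr rfl fun e _ => by rw [hι.extend_apply, mul_comm]
  rw [h1, h2]

/-- Codimension bookkeeping: pulling a direction space back along the zero-extension does not raise the codimension. -/
theorem codim_comap_extend_le (hι : Function.Injective ι) (K' : Submodule ℂ (Fin n' × Fin n' → ℂ)) :
    n * n - Module.finrank ℂ (K'.comap (Function.ExtendByZero.linearMap ℂ ι)) ≤
      n' * n' - Module.finrank ℂ K' := by
  set E := Function.ExtendByZero.linearMap ℂ ι with hE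
  have hEinj : Function.Injective E := by
    intro v w h
    funext e
    have := congr_fun h (ι e)
    simpa [hE, Function.ExtendByZero.linearMap_apply, hι.extend_apply] using this
  set K := K'.comap E with hK
  have hmap : K.map E = LinearMap.range E ⊓ K' := by rw [hK, Submodule.map_comap_eq]
  have hdimK : Module.finrank ℂ (K.map E) = Module.finrank ℂ K :=
    (LinearEquiv.finrank_eq (Submodule.equivMapOfInjective E hEinj K)).symm
  have hrange : Module.finrank ℂ (LinearMap.range E) = n * n := by
    rw [LinearMap.finrank_range_of_inj hEinj, Module.finrank_fintype_fun_eq_card, Fintype.card_prod, Fintype.card_fin]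
  have hsum := Submodule.finrank_sup_add_finrank_inf_eq (LinearMap.range E) K'
  rw [← hmap, hdimK, hrange] at hsum
  have hsup : Module.finrank ℂ ↥(LinearMap.range E ⊔ K') ≤ n' * n' := by
    calc Module.finrank ℂ ↥(LinearMap.range E ⊔ K') ≤ Module.finrank ℂ (Fin n' × Fin n' → ℂ) := Submodule.finrank_le _
      _ = n' * n' := by rw [Module.finrank_fintype_fun_eq_card, Fintype.card_prod, Fintype.card_fin]
  have hK' : Module.finrank ℂ K' ≤ n' * n' := by
    calc Module.finrank ℂ K' ≤ Module.finrank ℂ (Fin n' × Fin n' → ℂ) := Submodule.finrank_le _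
      _ = n' * n' := by rw [Module.finrank_fintype_fun_eq_card, Fintype.card_prod, Fintype.card_fin]
  omega

/-- ★★ **A CERTIFICATE OF THE HOMOGENISED PENCIL RESTRICTS TO A CERTIFICATE OF THE PENCIL, AT THE SAME PRICE** (window `n ≤ n'`). -/
theorem relCert_of_homog (hι : Function.Injective ι) (hs₀ : ∀ e, ι e ≠ s₀) (hn : n ≤ n') (hN : IsAffine N)
    (hN' : ∀ i j, N' i j = (∑ e, C (coeff (Finsupp.single e 1) (N i j)) * X (ι e)) + C (coeff 0 (N i j)) * X s₀)
    {P : ℕ} (h : RelCert n' b N' P) : RelCert n b N P := by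
  obtain ⟨K', k, hK', hprice⟩ := h
  refine ⟨K'.comap (Function.ExtendByZero.linearMap ℂ ι), k, ?_, ?_⟩
  · intro x v hv p hp i j _ _
    have hv' := Submodule.mem_comap.mp hv
    change Function.extend ι v (0 : Fin n' × Fin n' → ℂ) ∈ K' at hv'
    have hp' : p ≤ n' - 1 := hp.trans (by omega)
    have := hK' (Function.extend ι x (fun _ => 1)) _ hv' p hp' i j trivial trivial
    rwa [map_lineSubst_homog ι s₀ N' hι hs₀ hN hN'] at this
  · have hcod := codim_comap_extend_le ι hι K'
    have hk : n * k ≤ n' * k := Nat.mul_le_mul_right k hn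
    exact le_trans (Nat.add_le_add hk hcod) hprice

end Homog

/-! ## §4 (c) ⟺ (c) for LINEAR pencils -/

/-- `√(n+1) ≤ 2√n` for `n ≥ 1` (natural square roots). -/
theorem sqrt_succ_le_two_mul_sqrt {n : ℕ} (hn : 1 ≤ n) : Nat.sqrt (n + 1) ≤ 2 * Nat.sqrt n := by
  have h1 : Nat.sqrt (n + 1) ≤ Nat.sqrt n + 1 := Nat.sqrt_succ_le_succ_sqrt n
  have h2 : 1 ≤ Nat.sqrt n := Nat.le_sqrt.2 (by omega)
  omega

/-- ★★★ **THE CONSTANT PART IS FREE IN (c)**: if every LINEAR nilpotent `b × b` pencil (constant part `0`) over the `n²` coordinates,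
`n ≥ n₀`, has a certificate of price `≤ c·√n·b`, then `LongMassSlowLawAll` holds (with constants `2c`, `max n₀ 1`). -/
theorem longMassSlowLawAll_of_linear {c n₀ : ℕ}
    (h : ∀ n ≥ n₀, ∀ b : ℕ, ∀ B : AffMat n b, IsAffine B → (∀ i j, coeff 0 (B i j) = 0) → B ^ b = 0 →
      RelCert n b B (c * (Nat.sqrt n * b))) :
    LongMassSlowLawAll := by
  refine ⟨2 * c, max n₀ 1, fun n hn b B hB hnil => ?_⟩
  have hn₀ : n₀ ≤ n := le_trans (le_max_left _ _) hn
  have hn1 : 1 ≤ n := le_trans (le_max_right _ _) hn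
  -- the homogenised pencil over the `(n+1)²` coordinates
  set ι : Fin n × Fin n → Fin (n + 1) × Fin (n + 1) := Prod.map Fin.castSucc Fin.castSucc with hιdef
  set s₀ : Fin (n + 1) × Fin (n + 1) := (Fin.last n, Fin.last n) with hs₀def
  have hι : Function.Injective ι := Fin.castSucc_injective _ |>.prodMap (Fin.castSucc_injective _)
  have hs₀ : ∀ e, ι e ≠ s₀ := by
    intro e he
    have h1 : Fin.castSucc e.1 = Fin.last n := congr_arg Prod.fst he
    exact (Fin.castSucc_lt_last e.1).ne h1
  set N' : AffMat (n + 1) b := Matrix.of fun i j =>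
    (∑ e, C (coeff (Finsupp.single e 1) (B i j)) * X (ι e)) + C (coeff 0 (B i j)) * X s₀ with hN'def
  have hN' : ∀ i j, N' i j = (∑ e, C (coeff (Finsupp.single e 1) (B i j)) * X (ι e)) + C (coeff 0 (B i j)) * X s₀ :=
    fun i j => rfl
  have hcert : RelCert (n + 1) b N' (c * (Nat.sqrt (n + 1) * b)) :=
    h (n + 1) (by omega) b N' (isAffine_homog ι s₀ B N' hN') (coeff_zero_homog ι s₀ B N' hN')
      (homog_pow_eq_zero ι s₀ N' hB hnil hN')
  obtain ⟨K, k, hK, hprice⟩ := relCert_of_homog ι s₀ N' hι hs₀ (Nat.le_succ n) hB hN' hcert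
  refine ⟨K, k, hK, hprice.trans ?_⟩
  have hs := sqrt_succ_le_two_mul_sqrt hn1
  calc c * (Nat.sqrt (n + 1) * b) ≤ c * (2 * Nat.sqrt n * b) :=
        Nat.mul_le_mul_left c (Nat.mul_le_mul_right b hs)
    _ = 2 * c * (Nat.sqrt n * b) := by ring

/-- ★★★ **(c) ⟺ (c) FOR LINEAR PENCILS** (`LongMassSlowLawAll` form). -/
theorem longMassSlowLawAll_iff_linear :
    LongMassSlowLawAll ↔
      ∃ c n₀ : ℕ, ∀ n ≥ n₀, ∀ b : ℕ, ∀ B : AffMat n b, IsAffine B → (∀ i j, coeff 0 (B i j) = 0) → B ^ b = 0 →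
        RelCert n b B (c * (Nat.sqrt n * b)) := by
  constructor
  · rintro ⟨c, n₀, h⟩
    exact ⟨c, n₀, fun n hn b B hB _ hnil => h n hn b B hB hnil⟩
  · rintro ⟨c, n₀, h⟩
    exact longMassSlowLawAll_of_linear h

/-- ★★★ **(c) ⟺ (c) FOR LINEAR PENCILS** (the registered stub's `SlowCore.LongMassSlowLawInv` form, via ✓ `inv_iff_all`). -/
theorem longMassSlowLawInv_iff_linear :
    LongMassSlowLawInv ↔
      ∃ c n₀ : ℕ, ∀ n ≥ n₀, ∀ b : ℕ, ∀ B : AffMat n b, IsAffine B → (∀ i j, coeff 0 (B i j) = 0) → B ^ b = 0 →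
        RelCert n b B (c * (Nat.sqrt n * b)) := by
  rw [← longMassSlowLawAll_iff_linear]
  exact ⟨all_of_inv, inv_of_all⟩

end Summit.ValiantsHypothesis.ValiantsHypothesis.Theorems.GrenetZeon.LongMassHomogenise

end
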